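import Literature.Probability.MarkovChains.PathCoupling

/-!
HONEST FRAMING: exact (Metropolis-corrected) sampling algorithms for lattice gauge theory; figures
of merit are autocorrelation/cost numbers at stated couplings and volumes; no continuum-physics
claim.

# ClockConditionedContraction — CYCLE → STEP BY CONDITIONING ON THE CLOCK: FOR `S = σA + (1−σ)B`, IF THE `j`-ATTEMPT CYCLE KERNEL `C_j = AʲB` CONTRACTS A COST `ρ` (`≥ 1` OFF THE
# DIAGONAL) IN TRANSPORT DISTANCE BY `1 − r_j` FOR EVERY ATTEMPT COUNT `j`, THEN `‖Sⁿ(x,·) − Sⁿ(y,·)‖_TV ≤ u_n·ρ(x,y)` AND `d_S(n) ≤ D·u_n`, WHERE `u` SOLVES THE RENEWAL RECURSION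
# `u_n = Σ_{j<n} σʲ(1−σ)(1−r_j)u_{n−1−j} + σⁿ` (lean-2 GEN-39, ours)

Venture-side (OURS).  Cell `lqcd-flow` (pub-lqcd), unit `pub-lqcd-lean-2-g39`, 2026-08-30.  Chapter Y, file C1 — the generic half of OPEN-MATH item 1 (i) (b′) (the SHARP logarithm of the
step-count law).  Chapter X typed the spectral route (`t_mix^{steps}` up to `½log(1/π_min)`); the route to the sharp logarithm is a coupling in step time, and a coupling of two copies of
`S = σA + (1−σ)B` at EQUAL times must share the letter sequence (the clock), so what it can use per refresh cycle is the contraction of the `j`-ATTEMPT cycle kernel `C_j = AʲB` for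
the realised `j` — not the contraction of the geometric mixture `C = Σ_j σʲ(1−σ)C_j = UB` of chapters V–W (the two differ: a cycle chain can contract by clock randomness alone while
the step chain does not, MEMO-gen39 §3).  This file does the bookkeeping once and for all, for ANY kernels `A, B ≥ 0` with unit row sums on a finite space and any `σ ∈ [0,1)`:

* the FIRST-`B` DECOMPOSITION `Sⁿ = Σ_{j<n} σʲ(1−σ)·C_jSⁿ⁻¹⁻ʲ + σⁿAⁿ` (`clock_firstB`);
* if `ρ(x,x) = 0`, `ρ(x,y) ≥ 1` for `x ≠ y`, and for every `j` and every pair `ρ_K(C_j(x,·),C_j(y,·)) ≤ (1−r_j)ρ(x,y)` with `r_j ≤ 1`, then for the solution `u` of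
  `u_n = Σ_{j<n}σʲ(1−σ)(1−r_j)u_{n−1−j} + σⁿ` (`u_0 = 1`): **`‖Sⁿ(x,·) − Sⁿ(y,·)‖_TV ≤ u_n·ρ(x,y)`** (`clock_pair_tvDist_le`) and, for a stationary probability vector `π` and `ρ ≤ D`,
  **`d_S(n) ≤ D·u_n`** (`clock_worstTvDist_le`).

The probabilistic reading of `u_n` is `E[Π_{cycles completed by time n}(1 − r_{j_i})]`; its bounds (`u_n ≤ (1−r̃)ᵏ + P{Bin(n,1−σ) < k}` for rates in `[0,1]` averaging to `r̃`, and a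
geometric bound for signed rates) and the mixing-time corollaries are file C2.  Hypothesis-equations, no definitions; the matrix powers `Sⁿ`, `Aⁿ` and the cycle kernels `C_j` are
supplied by their recursions.

## What is proved

* §1 plumbing: `clock_tvDist_sum_le` (convexity of `‖·‖_TV` along a common mixture), `clock_tvDist_add_le`, `clock_tvDist_coupling_le` (`‖μP − νP‖_TV ≤ Σ q(a,b)‖P(a,·) − P(b,·)‖_TV`
  for a coupling `q` of `μ, ν`), `clock_pow_rowStochastic`, `clock_cycle_rowStochastic`, `clock_pow_comm`, `clock_lawAt_eq`, **`clock_firstB`**, `clock_u_nonneg`.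
* §2 **`clock_pair_tvDist_le`**, **`clock_worstTvDist_le`**.

Reading (no numerics implied): generic; the lumped star needs per-attempt-count contraction rates (Conjecture W′'s shape) to instantiate it.  Literature grade (cell rule): OWN,
elementary, on the tree's LPW transport-metric file; nothing cited as a fact; no new bib keys.
-/

open Finset
open Literature.Probability.MarkovChains

namespace Summit.Ventures.LatticeQCDFlow.Scaling

section ClockPlumbing
variable {X : Type*} [Fintype X] [DecidableEq X]

omit [DecidableEq X] in
/-- **Convexity of total variation along a common mixture:** `‖Σ_i w_iμ_i − Σ_i w_iν_i‖_TV ≤ Σ_i w_i‖μ_i − ν_i‖_TV` for `w ≥ 0`. [ours] -/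
theorem clock_tvDist_sum_le {ι : Type*} (s : Finset ι) {w : ι → ℝ} (hw : ∀ i ∈ s, 0 ≤ w i) (μ ν : ι → X → ℝ) :
    tvDist (fun y => ∑ i ∈ s, w i * μ i y) (fun y => ∑ i ∈ s, w i * ν i y) ≤ ∑ i ∈ s, w i * tvDist (μ i) (ν i) := by
  unfold tvDist
  calc (1 / 2 : ℝ) * ∑ y, |∑ i ∈ s, w i * μ i y - ∑ i ∈ s, w i * ν i y|
      ≤ (1 / 2) * ∑ y, ∑ i ∈ s, w i * |μ i y - ν i y| := by
        refine mul_le_mul_of_nonneg_left (sum_le_sum fun y _ => ?_) (by norm_num)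
        rw [← sum_sub_distrib]
        refine (abs_sum_le_sum_abs _ _).trans (le_of_eq (sum_congr rfl fun i hi => ?_))
        rw [← mul_sub, abs_mul, abs_of_nonneg (hw i hi)]
    _ = ∑ i ∈ s, w i * ((1 / 2) * ∑ y, |μ i y - ν i y|) := by
        rw [sum_comm, mul_sum]; exact sum_congr rfl fun i _ => by rw [mul_sum, mul_sum, mul_sum]; exact sum_congr rfl fun y _ => by ring

omit [DecidableEq X] in
/-- Subadditivity: `‖(μ₁+μ₂) − (ν₁+ν₂)‖_TV ≤ ‖μ₁ − ν₁‖_TV + ‖μ₂ − ν₂‖_TV`. [ours] -/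
theorem clock_tvDist_add_le (μ₁ μ₂ ν₁ ν₂ : X → ℝ) :
    tvDist (fun y => μ₁ y + μ₂ y) (fun y => ν₁ y + ν₂ y) ≤ tvDist μ₁ ν₁ + tvDist μ₂ ν₂ := by
  unfold tvDist
  rw [← mul_add, ← sum_add_distrib]
  refine mul_le_mul_of_nonneg_left (sum_le_sum fun y _ => ?_) (by norm_num)
  calc |μ₁ y + μ₂ y - (ν₁ y + ν₂ y)| = |(μ₁ y - ν₁ y) + (μ₂ y - ν₂ y)| := by ring_nf
    _ ≤ |μ₁ y - ν₁ y| + |μ₂ y - ν₂ y| := abs_add_le _ _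

omit [DecidableEq X] in
/-- Scaling: `‖cμ − cν‖_TV = c‖μ − ν‖_TV` for `c ≥ 0`. [ours] -/
theorem clock_tvDist_smul {c : ℝ} (hc : 0 ≤ c) (μ ν : X → ℝ) : tvDist (fun y => c * μ y) (fun y => c * ν y) = c * tvDist μ ν := by
  unfold tvDist
  show (1 / 2 : ℝ) * ∑ y, |c * μ y - c * ν y| = c * ((1 / 2) * ∑ y, |μ y - ν y|)
  have e : ∑ y, |c * μ y - c * ν y| = c * ∑ y, |μ y - ν y| := by
    rw [mul_sum]; exact sum_congr rfl fun y _ => by rw [← mul_sub, abs_mul, abs_of_nonneg hc]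
  rw [e]; ring

omit [DecidableEq X] in
/-- **Coupling bound for one step:** if `q` couples `μ` and `ν` then `‖μP − νP‖_TV ≤ Σ_{a,b} q(a,b)·‖P(a,·) − P(b,·)‖_TV`. [ours] -/
theorem clock_tvDist_coupling_le (P : X → X → ℝ) {μ ν : X → ℝ} {q : X → X → ℝ} (hq : IsCoupling μ ν q) :
    tvDist (stepLaw P μ) (stepLaw P ν) ≤ ∑ a, ∑ b, q a b * tvDist (P a) (P b) := by
  have hμ : stepLaw P μ = fun y => ∑ p : X × X, q p.1 p.2 * P p.1 y := by
    funext y; unfold stepLaw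
    rw [Fintype.sum_prod_type]
    exact sum_congr rfl fun a _ => by dsimp only; rw [← sum_mul, hq.2.1 a]
  have hν : stepLaw P ν = fun y => ∑ p : X × X, q p.1 p.2 * P p.2 y := by
    funext y; unfold stepLaw
    rw [Fintype.sum_prod_type, sum_comm]
    exact sum_congr rfl fun b _ => by dsimp only; rw [← sum_mul, hq.2.2 b]
  rw [hμ, hν]
  refine (clock_tvDist_sum_le (univ : Finset (X × X)) (fun p _ => hq.1 p.1 p.2) (fun p => P p.1) (fun p => P p.2)).trans (le_of_eq ?_)
  rw [Fintype.sum_prod_type]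

/-- Powers (left recursion `Mⁿ⁺¹ = M·Mⁿ`) of a kernel `M ≥ 0` with unit row sums are kernels `≥ 0` with unit row sums. [ours] -/
theorem clock_pow_rowStochastic {M : X → X → ℝ} (hM0 : ∀ x y, 0 ≤ M x y) (hM1 : ∀ x, ∑ y, M x y = 1) {Mn : ℕ → X → X → ℝ}
    (hMn0 : ∀ x y, Mn 0 x y = if x = y then 1 else 0) (hMns : ∀ n x y, Mn (n + 1) x y = ∑ z, M x z * Mn n z y) (n : ℕ) :
    (∀ x y, 0 ≤ Mn n x y) ∧ ∀ x, ∑ y, Mn n x y = 1 := by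
  classical
  induction n with
  | zero => exact ⟨fun x y => by rw [hMn0]; split_ifs <;> norm_num, fun x => by simp_rw [hMn0]; simp⟩
  | succ n ih =>
      refine ⟨fun x y => ?_, fun x => ?_⟩
      · rw [hMns]; exact sum_nonneg fun z _ => mul_nonneg (hM0 x z) (ih.1 z y)
      · simp_rw [hMns]; rw [sum_comm]
        calc ∑ z, ∑ y, M x z * Mn n z y = ∑ z, M x z := sum_congr rfl fun z _ => by rw [← mul_sum, ih.2 z, mul_one]
          _ = 1 := hM1 x

omit [DecidableEq X] in
/-- The cycle kernels `C_j = AʲB` (recursion `C_{j+1} = A·C_j`) are kernels `≥ 0` with unit row sums. [ours] -/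
theorem clock_cycle_rowStochastic {A B : X → X → ℝ} (hA0 : ∀ x y, 0 ≤ A x y) (hA1 : ∀ x, ∑ y, A x y = 1) (hB0 : ∀ x y, 0 ≤ B x y) (hB1 : ∀ x, ∑ y, B x y = 1)
    {C : ℕ → X → X → ℝ} (hC0 : ∀ x y, C 0 x y = B x y) (hCs : ∀ j x y, C (j + 1) x y = ∑ z, A x z * C j z y) (j : ℕ) :
    (∀ x y, 0 ≤ C j x y) ∧ ∀ x, ∑ y, C j x y = 1 := by
  induction j with
  | zero => exact ⟨fun x y => by rw [hC0]; exact hB0 x y, fun x => by simp_rw [hC0]; exact hB1 x⟩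
  | succ j ih =>
      refine ⟨fun x y => ?_, fun x => ?_⟩
      · rw [hCs]; exact sum_nonneg fun z _ => mul_nonneg (hA0 x z) (ih.1 z y)
      · simp_rw [hCs]; rw [sum_comm]
        calc ∑ z, ∑ y, A x z * C j z y = ∑ z, A x z := sum_congr rfl fun z _ => by rw [← mul_sum, ih.2 z, mul_one]
          _ = 1 := hA1 x

/-- Left and right recursions of the powers agree: `Σ_z M(x,z)Mⁿ(z,y) = Σ_z Mⁿ(x,z)M(z,y)`. [ours] -/
theorem clock_pow_comm {M : X → X → ℝ} {Mn : ℕ → X → X → ℝ} (hMn0 : ∀ x y, Mn 0 x y = if x = y then 1 else 0)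
    (hMns : ∀ n x y, Mn (n + 1) x y = ∑ z, M x z * Mn n z y) (n : ℕ) : ∀ x y, Mn (n + 1) x y = ∑ z, Mn n x z * M z y := by
  classical
  induction n with
  | zero => intro x y; rw [hMns]; simp_rw [hMn0]; simp [Finset.sum_ite_eq, Finset.sum_ite_eq']
  | succ n ih =>
      intro x y
      rw [hMns]
      have e : ∀ z, Mn (n + 1) z y = ∑ w, Mn n z w * M w y := fun z => ih z y
      simp_rw [e, mul_sum]
      rw [sum_comm]
      refine sum_congr rfl fun w _ => ?_
      rw [hMns, sum_mul]
      exact sum_congr rfl fun z _ => by ring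

/-- The law at time `n` is the start law pushed through the `n`-th power: `μSⁿ = stepLaw Sⁿ μ`. [ours] -/
theorem clock_lawAt_eq {S : X → X → ℝ} {Sn : ℕ → X → X → ℝ} (hSn0 : ∀ x y, Sn 0 x y = if x = y then 1 else 0)
    (hSns : ∀ n x y, Sn (n + 1) x y = ∑ z, S x z * Sn n z y) (μ : X → ℝ) (n : ℕ) : lawAt S μ n = stepLaw (Sn n) μ := by
  classical
  induction n with
  | zero => funext y; rw [lawAt_zero]; unfold stepLaw; simp_rw [hSn0]; simp
  | succ n ih =>
      rw [lawAt_succ, ih]; funext y; unfold stepLaw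
      simp_rw [clock_pow_comm hSn0 hSns n, sum_mul, mul_sum]
      rw [sum_comm]
      exact sum_congr rfl fun a _ => sum_congr rfl fun b _ => by ring

/-- From a point mass: `δ_xSⁿ = Sⁿ(x,·)`. [ours] -/
theorem clock_lawAt_single {S : X → X → ℝ} {Sn : ℕ → X → X → ℝ} (hSn0 : ∀ x y, Sn 0 x y = if x = y then 1 else 0)
    (hSns : ∀ n x y, Sn (n + 1) x y = ∑ z, S x z * Sn n z y) (x : X) (n : ℕ) : lawAt S (Pi.single x 1) n = Sn n x := by
  rw [clock_lawAt_eq hSn0 hSns]; funext y; unfold stepLaw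
  rw [Finset.sum_eq_single x (fun a _ hax => by rw [Pi.single_eq_of_ne hax, zero_mul]) (fun h => absurd (mem_univ x) h)]
  simp

/-- **THE FIRST-`B` DECOMPOSITION:** `Sⁿ(x,y) = Σ_{j<n} σʲ(1−σ)·Σ_z C_j(x,z)Sⁿ⁻¹⁻ʲ(z,y) + σⁿAⁿ(x,y)` — decompose by the time `j+1` of the first `B`-letter (or none in `n` steps). [ours] -/
theorem clock_firstB {A B S : X → X → ℝ} {σ : ℝ} (hS : ∀ x y, S x y = σ * A x y + (1 - σ) * B x y)
    {Sn An C : ℕ → X → X → ℝ} (hSn0 : ∀ x y, Sn 0 x y = if x = y then 1 else 0) (hSns : ∀ n x y, Sn (n + 1) x y = ∑ z, S x z * Sn n z y)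
    (hAn0 : ∀ x y, An 0 x y = if x = y then 1 else 0) (hAns : ∀ n x y, An (n + 1) x y = ∑ z, A x z * An n z y)
    (hC0 : ∀ x y, C 0 x y = B x y) (hCs : ∀ j x y, C (j + 1) x y = ∑ z, A x z * C j z y) (n : ℕ) :
    ∀ x y, Sn n x y = (∑ j ∈ range n, σ ^ j * (1 - σ) * ∑ z, C j x z * Sn (n - 1 - j) z y) + σ ^ n * An n x y := by
  classical
  induction n with
  | zero => intro x y; rw [hSn0, hAn0]; simp
  | succ n ih =>
      intro x y
      rw [hSns]
      -- expand `S(x,z)`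
      have e1 : ∑ z, S x z * Sn n z y = σ * ∑ z, A x z * Sn n z y + (1 - σ) * ∑ z, B x z * Sn n z y := by
        rw [mul_sum, mul_sum, ← sum_add_distrib]; exact sum_congr rfl fun z _ => by rw [hS]; ring
      -- the `A`-branch: substitute the inductive hypothesis and advance every cycle kernel and the no-`B` power by one `A`-step
      have eA : ∑ z, A x z * Sn n z y
          = (∑ j ∈ range n, σ ^ j * (1 - σ) * ∑ w, C (j + 1) x w * Sn (n - 1 - j) w y) + σ ^ n * An (n + 1) x y := by
        have step1 : ∑ z, A x z * Sn n z y
            = (∑ j ∈ range n, σ ^ j * (1 - σ) * ∑ z, A x z * ∑ w, C j z w * Sn (n - 1 - j) w y) + σ ^ n * ∑ z, A x z * An n z y := by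
          calc ∑ z, A x z * Sn n z y
              = ∑ z, ((∑ j ∈ range n, σ ^ j * (1 - σ) * (A x z * ∑ w, C j z w * Sn (n - 1 - j) w y)) + σ ^ n * (A x z * An n z y)) := by
                refine sum_congr rfl fun z _ => ?_
                rw [ih z y, mul_add, mul_sum]
                congr 1
                · exact sum_congr rfl fun j _ => by ring
                · ring
            _ = (∑ j ∈ range n, σ ^ j * (1 - σ) * ∑ z, A x z * ∑ w, C j z w * Sn (n - 1 - j) w y) + σ ^ n * ∑ z, A x z * An n z y := by
                rw [sum_add_distrib, sum_comm, ← mul_sum]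
                congr 1
                exact sum_congr rfl fun j _ => by rw [mul_sum]
        rw [step1, ← hAns]
        congr 1
        refine sum_congr rfl fun j _ => ?_
        congr 1
        simp_rw [hCs, mul_sum, sum_mul]
        rw [sum_comm]
        exact sum_congr rfl fun w _ => sum_congr rfl fun z _ => by ring
      have e3 : ∀ j ∈ range n, σ ^ (j + 1) * (1 - σ) * ∑ w, C (j + 1) x w * Sn (n + 1 - 1 - (j + 1)) w y
          = σ * (σ ^ j * (1 - σ) * ∑ w, C (j + 1) x w * Sn (n - 1 - j) w y) := by
        intro j hj
        have hjn : j < n := mem_range.mp hj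
        have e4 : n + 1 - 1 - (j + 1) = n - 1 - j := by omega
        rw [e4, pow_succ]; ring
      rw [e1, eA, sum_range_succ', sum_congr rfl e3, ← mul_sum, pow_zero, one_mul, show n + 1 - 1 - 0 = n by omega]
      simp_rw [hC0]
      ring

/-- The renewal sequence `u_n = Σ_{j<n}σʲ(1−σ)(1−r_j)u_{n−1−j} + σⁿ` is non-negative when `0 ≤ σ ≤ 1` and `r ≤ 1`. [ours] -/
theorem clock_u_nonneg {σ : ℝ} (hσ0 : 0 ≤ σ) (hσ1 : σ ≤ 1) {r u : ℕ → ℝ} (hr1 : ∀ j, r j ≤ 1)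
    (hu : ∀ n, u n = (∑ j ∈ range n, σ ^ j * (1 - σ) * (1 - r j) * u (n - 1 - j)) + σ ^ n) (n : ℕ) : 0 ≤ u n := by
  induction n using Nat.strong_induction_on with
  | _ n ih =>
      rw [hu n]
      refine add_nonneg (sum_nonneg fun j hj => ?_) (pow_nonneg hσ0 n)
      have := mem_range.mp hj
      exact mul_nonneg (mul_nonneg (mul_nonneg (pow_nonneg hσ0 j) (by linarith)) (by linarith [hr1 j])) (ih _ (by omega))

end ClockPlumbing

section ClockMain
variable {X : Type*} [Fintype X] [DecidableEq X]
variable {A B S : X → X → ℝ} {σ : ℝ} {Sn An C : ℕ → X → X → ℝ} {ρ : X → X → ℝ} {r u : ℕ → ℝ} {D : ℝ}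

/-- **CLOCK-CONDITIONED CONTRACTION OF PAIRS.**  `A, B ≥ 0` with unit row sums, `0 ≤ σ < 1`, `S = σA + (1−σ)B`; a cost `ρ` with `ρ(x,x) = 0` and `ρ(x,y) ≥ 1` for `x ≠ y`; for every
attempt count `j` and every pair the `j`-attempt cycle kernel `C_j = AʲB` contracts: `ρ_K(C_j(x,·),C_j(y,·)) ≤ (1−r_j)ρ(x,y)` with `r_j ≤ 1`.  Then for the renewal sequence
`u_n = Σ_{j<n}σʲ(1−σ)(1−r_j)u_{n−1−j} + σⁿ`: **`‖Sⁿ(x,·) − Sⁿ(y,·)‖_TV ≤ u_n·ρ(x,y)`** for all `n, x, y`. [ours] -/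
theorem clock_pair_tvDist_le (hA0 : ∀ x y, 0 ≤ A x y) (hA1 : ∀ x, ∑ y, A x y = 1) (hB0 : ∀ x y, 0 ≤ B x y) (hB1 : ∀ x, ∑ y, B x y = 1)
    (hσ0 : 0 ≤ σ) (hσ1 : σ < 1) (hS : ∀ x y, S x y = σ * A x y + (1 - σ) * B x y)
    (hSn0 : ∀ x y, Sn 0 x y = if x = y then 1 else 0) (hSns : ∀ n x y, Sn (n + 1) x y = ∑ z, S x z * Sn n z y)
    (hAn0 : ∀ x y, An 0 x y = if x = y then 1 else 0) (hAns : ∀ n x y, An (n + 1) x y = ∑ z, A x z * An n z y)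
    (hC0 : ∀ x y, C 0 x y = B x y) (hCs : ∀ j x y, C (j + 1) x y = ∑ z, A x z * C j z y)
    (hρd : ∀ x, ρ x x = 0) (hρ1 : ∀ x y, x ≠ y → 1 ≤ ρ x y)
    (hr1 : ∀ j, r j ≤ 1) (hcontr : ∀ j x y, transportDist ρ (C j x) (C j y) ≤ (1 - r j) * ρ x y)
    (hu : ∀ n, u n = (∑ j ∈ range n, σ ^ j * (1 - σ) * (1 - r j) * u (n - 1 - j)) + σ ^ n) :
    ∀ n x y, tvDist (Sn n x) (Sn n y) ≤ u n * ρ x y := by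
  classical
  have hSrs : (∀ x y, 0 ≤ S x y) ∧ ∀ x, ∑ y, S x y = 1 := by
    refine ⟨fun x y => by rw [hS]; exact add_nonneg (mul_nonneg hσ0 (hA0 x y)) (mul_nonneg (by linarith) (hB0 x y)), fun x => ?_⟩
    simp_rw [hS]; rw [sum_add_distrib, ← mul_sum, ← mul_sum, hA1, hB1]; ring
  intro n
  induction n using Nat.strong_induction_on with
  | _ n ih =>
      intro x y
      have hAn := clock_pow_rowStochastic hA0 hA1 hAn0 hAns n
      have hC := clock_cycle_rowStochastic hA0 hA1 hB0 hB1 hC0 hCs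
      -- both laws as the same mixture over the first-`B` time, plus the no-`B` branch
      have ex : Sn n x = fun w => (∑ j ∈ range n, (σ ^ j * (1 - σ)) * stepLaw (Sn (n - 1 - j)) (C j x) w) + σ ^ n * An n x w := by
        funext w; rw [clock_firstB hS hSn0 hSns hAn0 hAns hC0 hCs n x w]; rfl
      have ey : Sn n y = fun w => (∑ j ∈ range n, (σ ^ j * (1 - σ)) * stepLaw (Sn (n - 1 - j)) (C j y) w) + σ ^ n * An n y w := by
        funext w; rw [clock_firstB hS hSn0 hSns hAn0 hAns hC0 hCs n y w]; rfl
      rw [ex, ey]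
      refine (clock_tvDist_add_le _ _ _ _).trans ?_
      rw [hu n, add_mul]
      refine add_le_add ?_ ?_
      · -- the cycle branches: coupling of `C_j(x,·), C_j(y,·)` then the inductive Lipschitz bound for `Sⁿ⁻¹⁻ʲ`
        refine (clock_tvDist_sum_le (range n) (fun j _ => mul_nonneg (pow_nonneg hσ0 j) (by linarith)) _ _).trans ?_
        rw [sum_mul]
        refine sum_le_sum fun j hj => ?_
        have hjn : n - 1 - j < n := by have := mem_range.mp hj; omega
        have hne : (couplings (C j x) (C j y)).Nonempty := couplings_nonempty (fun a => (hC j).1 x a) (fun b => (hC j).1 y b) ((hC j).2 x) ((hC j).2 y)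
        obtain ⟨q, hq, hqopt, -⟩ := LevinPeres2017_rem_14_2 ρ hne
        have hum : 0 ≤ u (n - 1 - j) := clock_u_nonneg hσ0 hσ1.le hr1 hu _
        calc σ ^ j * (1 - σ) * tvDist (stepLaw (Sn (n - 1 - j)) (C j x)) (stepLaw (Sn (n - 1 - j)) (C j y))
            ≤ σ ^ j * (1 - σ) * ∑ a, ∑ b, q a b * tvDist (Sn (n - 1 - j) a) (Sn (n - 1 - j) b) :=
              mul_le_mul_of_nonneg_left (clock_tvDist_coupling_le _ hq) (mul_nonneg (pow_nonneg hσ0 j) (by linarith))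
          _ ≤ σ ^ j * (1 - σ) * ∑ a, ∑ b, q a b * (u (n - 1 - j) * ρ a b) :=
              mul_le_mul_of_nonneg_left (sum_le_sum fun a _ => sum_le_sum fun b _ => mul_le_mul_of_nonneg_left (ih _ hjn a b) (hq.1 a b)) (mul_nonneg (pow_nonneg hσ0 j) (by linarith))
          _ = σ ^ j * (1 - σ) * (u (n - 1 - j) * transportCost ρ q) := by
              congr 1; unfold transportCost; rw [mul_sum]; exact sum_congr rfl fun a _ => by rw [mul_sum]; exact sum_congr rfl fun b _ => by ring
          _ ≤ σ ^ j * (1 - σ) * (u (n - 1 - j) * ((1 - r j) * ρ x y)) := by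
              refine mul_le_mul_of_nonneg_left (mul_le_mul_of_nonneg_left ?_ hum) (mul_nonneg (pow_nonneg hσ0 j) (by linarith))
              rw [hqopt]; exact hcontr j x y
          _ = σ ^ j * (1 - σ) * (1 - r j) * u (n - 1 - j) * ρ x y := by ring
      · -- the no-`B` branch: total variation at most `1 ≤ ρ(x,y)` (and `0` on the diagonal)
        rw [clock_tvDist_smul (pow_nonneg hσ0 n)]
        refine mul_le_mul_of_nonneg_left ?_ (pow_nonneg hσ0 n)
        by_cases hxy : x = y
        · subst hxy; rw [tvDist_self, hρd]
        · exact (tvDist_le_one (hAn.1 x) (hAn.1 y) (hAn.2 x) (hAn.2 y)).trans (hρ1 x y hxy)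

/-- **`d_S(n) ≤ D·u_n`:** with a stationary probability vector `π` of `S` and `ρ ≤ D`, the worst-case total variation at time `n` is at most `D·u_n`. [ours] -/
theorem clock_worstTvDist_le (hA0 : ∀ x y, 0 ≤ A x y) (hA1 : ∀ x, ∑ y, A x y = 1) (hB0 : ∀ x y, 0 ≤ B x y) (hB1 : ∀ x, ∑ y, B x y = 1)
    (hσ0 : 0 ≤ σ) (hσ1 : σ < 1) (hS : ∀ x y, S x y = σ * A x y + (1 - σ) * B x y)
    (hSn0 : ∀ x y, Sn 0 x y = if x = y then 1 else 0) (hSns : ∀ n x y, Sn (n + 1) x y = ∑ z, S x z * Sn n z y)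
    (hAn0 : ∀ x y, An 0 x y = if x = y then 1 else 0) (hAns : ∀ n x y, An (n + 1) x y = ∑ z, A x z * An n z y)
    (hC0 : ∀ x y, C 0 x y = B x y) (hCs : ∀ j x y, C (j + 1) x y = ∑ z, A x z * C j z y)
    (hρd : ∀ x, ρ x x = 0) (hρ1 : ∀ x y, x ≠ y → 1 ≤ ρ x y) (hρD : ∀ x y, ρ x y ≤ D)
    (hr1 : ∀ j, r j ≤ 1) (hcontr : ∀ j x y, transportDist ρ (C j x) (C j y) ≤ (1 - r j) * ρ x y)
    (hu : ∀ n, u n = (∑ j ∈ range n, σ ^ j * (1 - σ) * (1 - r j) * u (n - 1 - j)) + σ ^ n)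
    {π : X → ℝ} (hπ0 : ∀ x, 0 ≤ π x) (hπ1 : ∑ x, π x = 1) (hπS : IsStationary π S) (n : ℕ) :
    worstTvDist S π n ≤ D * u n := by
  classical
  cases isEmpty_or_nonempty X with
  | inl h =>
      have h0 : worstTvDist S π n = 0 := Real.iSup_of_isEmpty _
      have : (∑ x, π x) = 0 := Finset.sum_eq_zero fun x _ => (IsEmpty.false x).elim
      rw [hπ1] at this; exact absurd this one_ne_zero
  | inr h =>
      refine ciSup_le fun x => ?_
      have hpair := clock_pair_tvDist_le hA0 hA1 hB0 hB1 hσ0 hσ1 hS hSn0 hSns hAn0 hAns hC0 hCs hρd hρ1 hr1 hcontr hu n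
      have hun : 0 ≤ u n := clock_u_nonneg hσ0 hσ1.le hr1 hu n
      -- `π = πSⁿ` is the `π`-mixture of the rows of `Sⁿ`, and `Sⁿ(x,·)` is the same mixture of the constant family
      rw [clock_lawAt_single hSn0 hSns x n, ← lawAt_eq_self_of_isStationary hπS n, clock_lawAt_eq hSn0 hSns π n]
      have ex : Sn n x = fun w => ∑ a, π a * Sn n x w := by funext w; rw [← sum_mul, hπ1, one_mul]
      have eπ : stepLaw (Sn n) π = fun w => ∑ a, π a * Sn n a w := rfl
      rw [ex, eπ]
      calc tvDist (fun w => ∑ a, π a * Sn n x w) (fun w => ∑ a, π a * Sn n a w)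
          ≤ ∑ a, π a * tvDist (Sn n x) (Sn n a) := clock_tvDist_sum_le univ (fun a _ => hπ0 a) (fun _ => Sn n x) (fun a => Sn n a)
        _ ≤ ∑ a, π a * (u n * D) := sum_le_sum fun a _ => mul_le_mul_of_nonneg_left ((hpair x a).trans (mul_le_mul_of_nonneg_left (hρD x a) hun)) (hπ0 a)
        _ = D * u n := by rw [← sum_mul, hπ1]; ring

end ClockMain

end Summit.Ventures.LatticeQCDFlow.Scaling
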